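import Mathlib
import Summits.Ventures.HodgeRepro2.T5InertCharacterCount

/-!
# The `μ`-twist: conjugate-SYMPLECTIC characters are as many as conjugate-orthogonal ones

Lemma N5.L4(ii)/(iii): «the conjugate-symplectic characters of `E_v^×` are exactly `μ·θ` with `θ`
conjugate-orthogonal, and `a(μθ) = a(θ)`; … the conjugate-symplectic characters of conductor `≤ n`
are `μθ` with `θ` a character of `E_v^×/F_v^×U_E^n` … so there are exactly `q` conjugate-symplectic
characters of conductor `1` and `(q+1)(q−1)` of conductor `2`». Here «conjugate-symplectic» =
`ξ|_{F_v^×} = η_v` ((A2)) and `μ` is any character of `E_v^×` with `μ|_{F_v^×} = η_v` and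
`μ|_{U_E} = 1` (unramified). The twist `χ ↦ μ·χ` is a bijection

  `{χ ∣ χ|_{F_v^× U_E^n} = 1}  ≃  {ξ ∣ ξ|_{F_v^×} = μ|_{F_v^×},  ξ|_{U_E^n} = 1}`

and preserves «exact conductor»; so the counts of `T5InertCharacterCount` transfer verbatim:

* `ncard_setOf_restrict_eq_and_eq_one`: `#{ξ ∣ ξ|_A = μ|_A, ξ|_V = 1} = #{χ ∣ χ|_{A ⊔ V} = 1}`
  for any `μ` trivial on `V` (abstract, any commutative `G`);
* `ncard_setOf_restrict_eq_and_eq_one_and_not`: the exact-level version;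
* `ncard_conjugateSymplectic_le`, `…_exact_one`, `…_exact_two`: `(q+1)q^{n-1}`, `q`, `(q+1)(q−1)`
  conjugate-symplectic characters at an inert place of `Kv ⊆ Lw` — the sentence as printed.

Declaration per README §8(d): «uses an L-value-free non-vanishing device: NO».
-/

namespace Summit.Ventures.HodgeRepro2.T5TwistedCharacterCount

open IsDedekindDomain HeightOneSpectrum T5PrincipalUnitFiltration T5CharacterCount
  T5InertCharacterCount

section Abstract

variable {G : Type*} [CommGroup G]

/-- The twist by `μ` maps the characters trivial on `A ⊔ V` onto the characters with `ξ|_A = μ|_A`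
and `ξ|_V = 1`, when `μ|_V = 1`. -/
theorem setOf_restrict_eq_and_eq_one_eq_image (A V : Subgroup G) (μ : G →* ℂˣ)
    (hμ : ∀ y ∈ V, μ y = 1) :
    {ξ : G →* ℂˣ | (∀ y ∈ A, ξ y = μ y) ∧ ∀ y ∈ V, ξ y = 1} =
      (fun χ : G →* ℂˣ => μ * χ) '' {χ : G →* ℂˣ | ∀ y ∈ A ⊔ V, χ y = 1} := by
  ext ξ
  constructor
  · rintro ⟨hA, hV⟩
    refine ⟨μ⁻¹ * ξ, fun y hy => ?_, mul_inv_cancel_left μ ξ⟩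
    obtain ⟨a, ha, z, hz, rfl⟩ := Subgroup.mem_sup.mp hy
    simp only [MonoidHom.mul_apply, MonoidHom.inv_apply, map_mul, hA a ha, hV z hz, hμ z hz]
    group
  · rintro ⟨χ, hχ, rfl⟩
    refine ⟨fun y hy => ?_, fun y hy => ?_⟩
    · simp [hχ y (Subgroup.mem_sup_left hy)]
    · simp [hχ y (Subgroup.mem_sup_right hy), hμ y hy]

/-- `#{ξ ∣ ξ|_A = μ|_A, ξ|_V = 1} = #{χ ∣ χ|_{A ⊔ V} = 1}` (`μ|_V = 1`). -/
theorem ncard_setOf_restrict_eq_and_eq_one (A V : Subgroup G) (μ : G →* ℂˣ)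
    (hμ : ∀ y ∈ V, μ y = 1) :
    {ξ : G →* ℂˣ | (∀ y ∈ A, ξ y = μ y) ∧ ∀ y ∈ V, ξ y = 1}.ncard =
      {χ : G →* ℂˣ | ∀ y ∈ A ⊔ V, χ y = 1}.ncard := by
  rw [setOf_restrict_eq_and_eq_one_eq_image A V μ hμ,
    Set.ncard_image_of_injective _ (mul_right_injective μ)]

/-- The exact-level version: `ξ|_A = μ|_A`, `ξ|_V = 1`, `ξ|_{V'} ≠ 1` (`V ≤ V'`, `μ|_{V'} = 1`). -/
theorem setOf_restrict_eq_and_eq_one_and_not_eq_image (A V V' : Subgroup G) (μ : G →* ℂˣ)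
    (hμ : ∀ y ∈ V', μ y = 1) (hVV' : V ≤ V') :
    {ξ : G →* ℂˣ | ((∀ y ∈ A, ξ y = μ y) ∧ ∀ y ∈ V, ξ y = 1) ∧ ¬ ∀ y ∈ V', ξ y = 1} =
      (fun χ : G →* ℂˣ => μ * χ) ''
        {χ : G →* ℂˣ | (∀ y ∈ A ⊔ V, χ y = 1) ∧ ¬ ∀ y ∈ A ⊔ V', χ y = 1} := by
  ext ξ
  constructor
  · rintro ⟨⟨hA, hV⟩, hV'⟩
    have hmem : ξ ∈ {ξ : G →* ℂˣ | (∀ y ∈ A, ξ y = μ y) ∧ ∀ y ∈ V, ξ y = 1} := ⟨hA, hV⟩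
    rw [setOf_restrict_eq_and_eq_one_eq_image A V μ (fun y hy => hμ y (hVV' hy))] at hmem
    obtain ⟨χ, hχ, rfl⟩ := hmem
    refine ⟨χ, ⟨hχ, fun h => hV' fun y hy => ?_⟩, rfl⟩
    simp [h y (Subgroup.mem_sup_right hy), hμ y hy]
  · rintro ⟨χ, ⟨hχ, hχ'⟩, rfl⟩
    have hmem : μ * χ ∈ {ξ : G →* ℂˣ | (∀ y ∈ A, ξ y = μ y) ∧ ∀ y ∈ V, ξ y = 1} := by
      rw [setOf_restrict_eq_and_eq_one_eq_image A V μ (fun y hy => hμ y (hVV' hy))]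
      exact ⟨χ, hχ, rfl⟩
    refine ⟨hmem, fun h => hχ' fun y hy => ?_⟩
    obtain ⟨a, ha, z, hz, rfl⟩ := Subgroup.mem_sup.mp hy
    have h1 := h z hz
    have h2 := hχ a (Subgroup.mem_sup_left ha)
    simp only [MonoidHom.mul_apply, hμ z hz, one_mul] at h1
    rw [map_mul, h2, h1, one_mul]

/-- `#{ξ ∣ ξ|_A = μ|_A, ξ|_V = 1, ξ|_{V'} ≠ 1} = #{χ ∣ χ|_{A ⊔ V} = 1, χ|_{A ⊔ V'} ≠ 1}`. -/
theorem ncard_setOf_restrict_eq_and_eq_one_and_not (A V V' : Subgroup G) (μ : G →* ℂˣ)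
    (hμ : ∀ y ∈ V', μ y = 1) (hVV' : V ≤ V') :
    {ξ : G →* ℂˣ | ((∀ y ∈ A, ξ y = μ y) ∧ ∀ y ∈ V, ξ y = 1) ∧ ¬ ∀ y ∈ V', ξ y = 1}.ncard =
      {χ : G →* ℂˣ | (∀ y ∈ A ⊔ V, χ y = 1) ∧ ¬ ∀ y ∈ A ⊔ V', χ y = 1}.ncard := by
  rw [setOf_restrict_eq_and_eq_one_and_not_eq_image A V V' μ hμ hVV',
    Set.ncard_image_of_injective _ (mul_right_injective μ)]

end Abstract

section Inert

variable {K : Type*} [Field K] [NumberField K] (v : HeightOneSpectrum (NumberField.RingOfIntegers K))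
variable {L : Type*} [Field L] [NumberField L]
  (w : HeightOneSpectrum (NumberField.RingOfIntegers L))
variable [Algebra (adicCompletion K v) (adicCompletion L w)]
  [ContinuousSMul (adicCompletion K v) (adicCompletion L w)]

variable {ϖ : adicCompletionIntegers K v} (hϖ : Irreducible ϖ)
  (hϖL : Irreducible (algebraMap (adicCompletionIntegers K v) (adicCompletionIntegers L w) ϖ))
  {q : ℕ} (hq : 2 ≤ q)
  (hk : Nat.card (IsLocalRing.ResidueField (adicCompletionIntegers K v)) = q)
  (hku : Nat.card (IsLocalRing.ResidueField (adicCompletionIntegers K v))ˣ = q - 1)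
  (hK : Nat.card (IsLocalRing.ResidueField (adicCompletionIntegers L w)) = q ^ 2)
  (hKu : Nat.card (IsLocalRing.ResidueField (adicCompletionIntegers L w))ˣ = q ^ 2 - 1)
  -- `μ`: any UNRAMIFIED character of `Lwˣ` (trivial on the units `U_E = U_E^0`); its restriction to
  -- `F_v^×` is the `η_v` of the conjugate-symplectic condition
  (μ : (adicCompletion L w)ˣ →* ℂˣ)
  (hμ : ∀ y ∈ (higherUnits (algebraMap (adicCompletionIntegers K v) (adicCompletionIntegers L w) ϖ)
    0).map (Units.map (algebraMap (adicCompletionIntegers L w) (adicCompletion L w) :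
      adicCompletionIntegers L w →* adicCompletion L w)), μ y = 1)

include hϖ hϖL hq hk hku hK hKu hμ

omit hϖ hϖL hq hk hku hK hKu in
/-- `μ` is trivial on every `U_E^n`. -/
theorem apply_eq_one_of_mem_map_higherUnits (n : ℕ) :
    ∀ y ∈ (higherUnits (algebraMap (adicCompletionIntegers K v) (adicCompletionIntegers L w) ϖ)
      n).map (Units.map (algebraMap (adicCompletionIntegers L w) (adicCompletion L w) :
        adicCompletionIntegers L w →* adicCompletion L w)), μ y = 1 :=
  fun y hy => hμ y (Subgroup.map_mono (higherUnits_antitone _ (Nat.zero_le n)) hy)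

/-- CONJUGATE-SYMPLECTIC characters of conductor `≤ n` (`n ≥ 1`) at an inert place: `(q+1)·q^{n-1}`. -/
theorem ncard_conjugateSymplectic_le {n : ℕ} (hn : 1 ≤ n) :
    {ξ : (adicCompletion L w)ˣ →* ℂˣ |
      (∀ y ∈ (T5UnramifiedCharacter.baseUnits v w).range, ξ y = μ y) ∧
      ∀ y ∈ (higherUnits (algebraMap (adicCompletionIntegers K v) (adicCompletionIntegers L w) ϖ)
        n).map (Units.map (algebraMap (adicCompletionIntegers L w) (adicCompletion L w) :
          adicCompletionIntegers L w →* adicCompletion L w)), ξ y = 1}.ncard =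
      (q + 1) * q ^ (n - 1) := by
  rw [ncard_setOf_restrict_eq_and_eq_one _ _ μ (apply_eq_one_of_mem_map_higherUnits v w μ hμ n),
    ncard_conjugateOrthogonal_le v w hϖ hϖL hq hk hku hK hKu hn]

/-- «exactly `q` conjugate-symplectic characters of conductor `1`». -/
theorem ncard_conjugateSymplectic_exact_one :
    {ξ : (adicCompletion L w)ˣ →* ℂˣ |
      ((∀ y ∈ (T5UnramifiedCharacter.baseUnits v w).range, ξ y = μ y) ∧
      ∀ y ∈ (higherUnits (algebraMap (adicCompletionIntegers K v) (adicCompletionIntegers L w) ϖ)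
        1).map (Units.map (algebraMap (adicCompletionIntegers L w) (adicCompletion L w) :
          adicCompletionIntegers L w →* adicCompletion L w)), ξ y = 1) ∧
      ¬ ∀ y ∈ (higherUnits (algebraMap (adicCompletionIntegers K v) (adicCompletionIntegers L w) ϖ)
        0).map (Units.map (algebraMap (adicCompletionIntegers L w) (adicCompletion L w) :
          adicCompletionIntegers L w →* adicCompletion L w)), ξ y = 1}.ncard = q := by
  rw [ncard_setOf_restrict_eq_and_eq_one_and_not _ _ _ μ hμ
    (Subgroup.map_mono (higherUnits_antitone _ zero_le_one)),
    ncard_conjugateOrthogonal_exact_one v w hϖ hϖL hq hk hku hK hKu]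

/-- «`(q+1)(q−1)` conjugate-symplectic characters of conductor `2`». -/
theorem ncard_conjugateSymplectic_exact_two :
    {ξ : (adicCompletion L w)ˣ →* ℂˣ |
      ((∀ y ∈ (T5UnramifiedCharacter.baseUnits v w).range, ξ y = μ y) ∧
      ∀ y ∈ (higherUnits (algebraMap (adicCompletionIntegers K v) (adicCompletionIntegers L w) ϖ)
        2).map (Units.map (algebraMap (adicCompletionIntegers L w) (adicCompletion L w) :
          adicCompletionIntegers L w →* adicCompletion L w)), ξ y = 1) ∧
      ¬ ∀ y ∈ (higherUnits (algebraMap (adicCompletionIntegers K v) (adicCompletionIntegers L w) ϖ)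
        1).map (Units.map (algebraMap (adicCompletionIntegers L w) (adicCompletion L w) :
          adicCompletionIntegers L w →* adicCompletion L w)), ξ y = 1}.ncard =
      (q + 1) * (q - 1) := by
  rw [ncard_setOf_restrict_eq_and_eq_one_and_not _ _ _ μ
    (apply_eq_one_of_mem_map_higherUnits v w μ hμ 1)
    (Subgroup.map_mono (higherUnits_antitone _ one_le_two)),
    ncard_conjugateOrthogonal_exact_two v w hϖ hϖL hq hk hku hK hKu]

end Inert

end Summit.Ventures.HodgeRepro2.T5TwistedCharacterCount
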